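import Mathlib
import HarnessLib
import Literature.NumberTheory.LFunctions.ZetaScrew
import Literature.NumberTheory.LFunctions.ZetaScrewHermitianFormsProofs
import Summits.RiemannHypothesis.RiemannHypothesis.Theorems.ZetaStringKernelOfWeilOn

/-!
# Route `IntegerScrew` — COERCIVE comb transfer: `L²`-coercivity of Weil's form on `C(a)` gives a
# quantitative floor for Suzuki's kernel on zero-sum configurations (RH-FREE glue)

`ZetaStringKernelOfWeilOn` transports `WeilPositivityOn a` (non-negativity of `Re Q` on `C(a)`) to
`0 ≤ Σᵢⱼ wᵢ wⱼ G(sᵢ, sⱼ)` for zero-sum real systems at points `|sᵢ| < a` (mollified combs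
`φ_ε = Σ wᵢ ρ_ε(· − sᵢ) ∈ 𝔈₀(a)`, the primitive `I₀φ_ε ∈ C(a)`, Prop. 3.1, uniform continuity of `G`).
This file keeps track of the `L²` norm of the primitive along the same argument: off the `ε`-balls
around the nodes, `I₀φ_ε` IS the step function `P(t) = Σ_{sᵢ < t} wᵢ` of the configuration, so

* `integral_sq_step_le` — `∫_{[−a,a]} P² ≤ ∫ ‖I₀φ_ε‖² + 2Nε (Σ|wᵢ|)²`;
* `sum_sum_zetaScrewKernel_ge_of_coercive` — **if `c·‖F‖₂² ≤ Re Q(F)` for every `F ∈ C(a)`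
  (`0 ≤ c`, `0 < a`), then `c · ∫_{[−a,a]} P(t)² dt ≤ Σᵢⱼ wᵢ wⱼ G(sᵢ, sⱼ)`** for every zero-sum real
  system `(sᵢ, wᵢ)` with `|sᵢ| < a`.

The hypothesis is supplied RH-free on short windows by Bombieri 2000 Thm. 12 (tree:
`Bombieri2000Thm12_holds`); the consequence for the integer screw matrices (a coercive floor
`≍ log(1/L)/M` on balanced windows of small log-length `L`) is drawn in a sequel.  LABEL: RH-FREE
glue; nothing here bears on the truth of RH.

References: M. Suzuki, J. Lond. Math. Soc. (2) 108 (2023) = arXiv:2206.03682, (1.4)–(1.5), (1.10)–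
(1.11), Prop. 3.1, §3.3 [Suzuki2023]; E. Bombieri, Rend. Lincei (9) 11 (2000) §4, §12 Thm. 12.
-/

noncomputable section

-- D-0017: `Summit.<S>.<S>.…` is the designed namespace of a single-problem summit.
set_option linter.dupNamespace false

namespace Summit.RiemannHypothesis.RiemannHypothesis.Theorems.IntegerScrew

open Literature.NumberTheory.LFunctions MeasureTheory Set Filter Metric Finset
open scoped Topology
open Summit.RiemannHypothesis.RiemannHypothesis.Theorems.KernelOfWeilOn

/-! ## §1 The primitive of a comb off the bumps is the step function of the configuration -/

/-- `∫_{−a}^{t} ρ(u − c) du = 1` when the bump at `c` (radius `β.rOut`) sits inside `[−a, t]`. [folklore] -/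
theorem intervalIntegral_normed_sub_eq_one (β : ContDiffBump (0 : ℝ)) {a c t : ℝ}
    (hc : |c| + β.rOut ≤ a) (hct : c + β.rOut ≤ t) :
    ∫ u in (-a)..t, β.normed volume (u - c) = 1 := by
  rw [intervalIntegral.integral_eq_integral_of_support_subset, integral_sub_right_eq_self,
    β.integral_normed]
  intro u hu
  rw [Function.mem_support] at hu
  have hlt : |u - c| < β.rOut := not_le.1 fun h => hu (normed_sub_eq_zero β h)
  have hca : -a ≤ c - β.rOut := by have := (abs_le.1 (show |c| ≤ a - β.rOut by linarith)); linarith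
  constructor
  · have := (abs_lt.1 hlt).1; linarith
  · have := (abs_lt.1 hlt).2; linarith

/-- `∫_{−a}^{t} ρ(u − c) du = 0` when the bump at `c` sits to the right of `t` (and `−a ≤ t`). [folklore] -/
theorem intervalIntegral_normed_sub_eq_zero (β : ContDiffBump (0 : ℝ)) {a c t : ℝ}
    (hat : -a ≤ t) (htc : t ≤ c - β.rOut) :
    ∫ u in (-a)..t, β.normed volume (u - c) = 0 := by
  rw [intervalIntegral.integral_congr (g := fun _ => (0 : ℝ)) fun u hu => ?_,
    intervalIntegral.integral_zero]
  rw [uIcc_of_le hat] at hu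
  have hu2 : u ≤ t := hu.2
  have hr := β.rOut_pos
  refine normed_sub_eq_zero β ?_
  rw [abs_sub_comm, abs_of_nonneg (by linarith)]
  linarith

/-- **Off the bumps the primitive of the comb is the step function**: if `|t − sᵢ| ≥ β.rOut` for all `i`
(and `t ∈ [−a, a]`, all bumps inside the window), then
`(I₀^{(a)} φ)(t) = Σ_{i : sᵢ < t} wᵢ` for `φ = Σ wᵢ ρ(· − sᵢ)`. [folklore] -/
theorem screwPrimitive_comb_eq_step {N : ℕ} (s w : Fin N → ℝ) (β : ContDiffBump (0 : ℝ)) {a t : ℝ}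
    (hsβ : ∀ i, |s i| + β.rOut ≤ a) (hat : -a ≤ t) (hgood : ∀ i, β.rOut ≤ |t - s i|) :
    screwPrimitive a 0 (fun u => ((comb s w β u : ℝ) : ℂ)) t =
      ((∑ i, if s i < t then w i else 0 : ℝ) : ℂ) := by
  unfold screwPrimitive
  rw [add_zero, intervalIntegral.integral_ofReal]
  congr 1
  unfold comb
  have hint : ∀ i ∈ (Finset.univ : Finset (Fin N)),
      IntervalIntegrable (fun u => w i * β.normed volume (u - s i)) volume (-a) t :=
    fun i _ => ((continuous_const.mul (continuous_normed_sub β (s i))).intervalIntegrable _ _)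
  rw [intervalIntegral.integral_finsetSum hint]
  refine Finset.sum_congr rfl fun i _ => ?_
  rw [intervalIntegral.integral_const_mul]
  by_cases hi : s i < t
  · rw [if_pos hi]
    have hct : s i + β.rOut ≤ t := by
      have h := hgood i
      rw [abs_of_pos (sub_pos.2 hi)] at h
      linarith
    rw [intervalIntegral_normed_sub_eq_one β (hsβ i) hct, mul_one]
  · rw [if_neg hi]
    have htc : t ≤ s i - β.rOut := by
      have h := hgood i
      rw [abs_of_nonpos (sub_nonpos.2 (not_lt.1 hi))] at h
      linarith
    rw [intervalIntegral_normed_sub_eq_zero β hat htc, mul_zero]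

/-! ## §2 The `L²` energy of the step function is carried by the primitive, up to the bumps -/

/-- The step function of a configuration is bounded by `Σ|wᵢ|`. [folklore] -/
theorem abs_step_le {N : ℕ} (s w : Fin N → ℝ) (t : ℝ) :
    |∑ i, if s i < t then w i else 0| ≤ ∑ i, |w i| := by
  refine (Finset.abs_sum_le_sum_abs _ _).trans (Finset.sum_le_sum fun i _ => ?_)
  split_ifs
  · exact le_rfl
  · rw [abs_zero]; exact abs_nonneg _

/-- The step function of a configuration is measurable. [folklore] -/
theorem measurable_step {N : ℕ} (s w : Fin N → ℝ) :
    Measurable fun t : ℝ => ∑ i, if s i < t then w i else 0 := by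
  refine Finset.measurable_sum _ fun i _ => ?_
  exact Measurable.ite (measurableSet_Ioi : MeasurableSet {t : ℝ | s i < t}) measurable_const
    measurable_const

/-- **`∫_{[−a,a]} P² ≤ ∫ ‖I₀φ_ε‖² + 2Nε (Σ|wᵢ|)²`** for the zero-sum comb `φ_ε = Σ wᵢ ρ_ε(· − sᵢ)` with
all bumps inside the window: on `[−a,a]` minus the `ε`-balls the primitive is the step function `P`
(`screwPrimitive_comb_eq_step`), and the balls have total length `≤ 2Nε`, on which `P² ≤ (Σ|wᵢ|)²`.
[folklore] -/
theorem integral_sq_step_le {N : ℕ} (s w : Fin N → ℝ) (β : ContDiffBump (0 : ℝ)) {a : ℝ}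
    (hsβ : ∀ i, |s i| + β.rOut ≤ a) (hw : ∑ i, w i = 0) :
    ∫ t in Icc (-a) a, (∑ i, if s i < t then w i else 0) ^ 2 ≤
      (∫ t, ‖screwPrimitive a 0 (fun u => ((comb s w β u : ℝ) : ℂ)) t‖ ^ 2)
        + 2 * N * β.rOut * (∑ i, |w i|) ^ 2 := by
  set P : ℝ → ℝ := fun t => ∑ i, if s i < t then w i else 0 with hP
  set F : ℝ → ℂ := screwPrimitive a 0 (fun u => ((comb s w β u : ℝ) : ℂ)) with hF
  set B : ℝ := ∑ i, |w i| with hB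
  set bad : Set ℝ := ⋃ i, Metric.ball (s i) β.rOut with hbad
  have hbadm : MeasurableSet bad := MeasurableSet.iUnion fun i => measurableSet_ball
  -- `P²` is bounded and measurable, hence integrable on every finite-measure set
  have hPm : Measurable fun t => P t ^ 2 := (measurable_step s w).pow_const 2
  have hPb : ∀ t, ‖P t ^ 2‖ ≤ B ^ 2 := by
    intro t
    rw [Real.norm_eq_abs, abs_pow, hB]
    exact pow_le_pow_left₀ (abs_nonneg _) (abs_step_le s w t) 2
  have hPint : ∀ S : Set ℝ, volume S < ⊤ → IntegrableOn (fun t => P t ^ 2) S := fun S hS =>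
    Measure.integrableOn_of_bounded hS.ne hPm.aestronglyMeasurable (Eventually.of_forall hPb)
  -- `F ∈ C(a)`: `‖F‖²` is continuous with compact support, hence integrable
  have hmem := comb_mem_screwTestC0 (a := a) s w β hsβ hw
  have hFtest : F ∈ screwTestC a := screwPrimitive_mem_screwTestC hmem
  have hFint : Integrable (fun t => ‖F t‖ ^ 2) := by
    have hc : Continuous fun t => ‖F t‖ ^ 2 := (hFtest.1.1.continuous.norm).pow 2
    have hcs : HasCompactSupport (fun t => ‖F t‖ ^ 2) :=
      (hFtest.1.2.norm).comp_left (g := fun x : ℝ => x ^ 2) (by simp)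
    exact hc.integrable_of_hasCompactSupport hcs
  have hvol_Icc : volume (Icc (-a) a) < ⊤ := measure_Icc_lt_top
  -- off the balls, `P² = ‖F‖²`
  have hgood_eq : ∀ t ∈ Icc (-a) a \ bad, P t ^ 2 = ‖F t‖ ^ 2 := by
    intro t ht
    have hgood : ∀ i, β.rOut ≤ |t - s i| := by
      intro i
      by_contra h
      exact ht.2 (Set.mem_iUnion.2 ⟨i, by rw [Metric.mem_ball, Real.dist_eq]; exact not_le.1 h⟩)
    rw [hF, screwPrimitive_comb_eq_step s w β hsβ ht.1.1 hgood, Complex.norm_real, Real.norm_eq_abs,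
      sq_abs]
  -- split `[−a,a]` into the good part and the balls
  have hsplit : ∫ t in Icc (-a) a, P t ^ 2 =
      (∫ t in Icc (-a) a \ bad, P t ^ 2) + ∫ t in Icc (-a) a ∩ bad, P t ^ 2 := by
    rw [← setIntegral_union (Set.disjoint_sdiff_inter) (measurableSet_Icc.inter hbadm)
      (hPint _ ((measure_mono Set.sdiff_subset).trans_lt hvol_Icc))
      (hPint _ ((measure_mono Set.inter_subset_left).trans_lt hvol_Icc)), Set.sdiff_union_inter]
  -- the good part is carried by `‖F‖²`
  have hgood_le : ∫ t in Icc (-a) a \ bad, P t ^ 2 ≤ ∫ t, ‖F t‖ ^ 2 := by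
    rw [setIntegral_congr_fun (measurableSet_Icc.diff hbadm) hgood_eq]
    exact setIntegral_le_integral hFint (Eventually.of_forall fun t => by positivity)
  -- the balls have total length `≤ 2Nε`
  have hvol_bad : (volume (Icc (-a) a ∩ bad)).toReal ≤ 2 * N * β.rOut := by
    have h1 : volume (Icc (-a) a ∩ bad) ≤ ∑ i : Fin N, volume (Metric.ball (s i) β.rOut) :=
      (measure_mono Set.inter_subset_right).trans (measure_iUnion_fintype_le volume _)
    have h2 : ∑ i : Fin N, volume (Metric.ball (s i) β.rOut) =
        (N : ENNReal) * ENNReal.ofReal (2 * β.rOut) := by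
      rw [Finset.sum_congr rfl fun i _ => Real.volume_ball (s i) β.rOut, Finset.sum_const,
        Finset.card_univ, Fintype.card_fin, nsmul_eq_mul]
    rw [h2] at h1
    have hne : (N : ENNReal) * ENNReal.ofReal (2 * β.rOut) ≠ ⊤ :=
      ENNReal.mul_ne_top (ENNReal.natCast_ne_top N) ENNReal.ofReal_ne_top
    have h3 := ENNReal.toReal_mono hne h1
    rw [ENNReal.toReal_mul, ENNReal.toReal_natCast,
      ENNReal.toReal_ofReal (by linarith [β.rOut_pos.le])] at h3
    linarith
  have hbad_le : ∫ t in Icc (-a) a ∩ bad, P t ^ 2 ≤ 2 * N * β.rOut * B ^ 2 := by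
    have hfin : volume (Icc (-a) a ∩ bad) < ⊤ :=
      (measure_mono Set.inter_subset_left).trans_lt hvol_Icc
    have h := norm_setIntegral_le_of_norm_le_const (s := Icc (-a) a ∩ bad)
      (f := fun t => P t ^ 2) hfin (fun t _ => hPb t)
    rw [Real.norm_eq_abs] at h
    have h' := (abs_le.1 h).2
    have hB2 : 0 ≤ B ^ 2 := sq_nonneg _
    calc ∫ t in Icc (-a) a ∩ bad, P t ^ 2 ≤ B ^ 2 * (volume (Icc (-a) a ∩ bad)).toReal := h'
      _ ≤ B ^ 2 * (2 * N * β.rOut) := mul_le_mul_of_nonneg_left hvol_bad hB2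
      _ = 2 * N * β.rOut * B ^ 2 := by ring
  -- assemble
  show ∫ t in Icc (-a) a, P t ^ 2 ≤ (∫ t, ‖F t‖ ^ 2) + 2 * N * β.rOut * B ^ 2
  rw [hsplit]
  linarith

/-! ## §3 Coercivity of Weil's form on `C(a)` ⟹ a floor against the step energy -/

/-- **COERCIVE COMB TRANSFER** (RH-FREE glue): if Weil's quadratic form is `L²`-coercive on `C(a)`,
`c·∫‖F‖² ≤ Re Q(F)` for every test function `F` supported in `[−a, a]` (`0 < a`, `0 ≤ c`), then for
every zero-sum real system `(sᵢ, wᵢ)` with `|sᵢ| < a`: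
`c · ∫_{[−a,a]} (Σ_{sᵢ < t} wᵢ)² dt ≤ Σᵢⱼ wᵢ wⱼ G(sᵢ, sⱼ)`.
(Combs `φ_ε ∈ 𝔈₀(a)`, `I₀φ_ε ∈ C(a)`, Prop. 3.1 `Q(I₀φ_ε) = ⟨φ_ε, φ_ε⟩_{G,a} = D(φ_ε, φ_ε)`, uniform
continuity of `G` for the upper side, `integral_sq_step_le` for the lower side, `ε → 0`.)
[cite: Suzuki2023, Prop 3.1 and (1.10)–(1.11)] -/
theorem sum_sum_zetaScrewKernel_ge_of_coercive {a c : ℝ} (ha : 0 < a) (hc : 0 ≤ c)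
    (hcoer : ∀ F : ℝ → ℂ, IsWeilTest F → tsupport F ⊆ Icc (-a) a →
      c * ∫ t, ‖F t‖ ^ 2 ≤ (weilQuadratic F).re)
    {N : ℕ} (s w : Fin N → ℝ) (hs : ∀ i, |s i| < a) (hw : ∑ i, w i = 0) :
    c * ∫ t in Icc (-a) a, (∑ i, if s i < t then w i else 0) ^ 2 ≤
      ∑ i, ∑ j, w i * w j * zetaScrewKernel (s i) (s j) := by
  rcases Nat.eq_zero_or_pos N with hN | hN
  · subst hN; simp
  -- room `ε₀` between the configuration and the window edge
  haveI : Nonempty (Fin N) := Fin.pos_iff_nonempty.1 hN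
  obtain ⟨i₀, -, hi₀⟩ := Finset.exists_max_image Finset.univ (fun i => |s i|) Finset.univ_nonempty
  set ε₀ : ℝ := a - |s i₀| with hε₀def
  have hε₀ : 0 < ε₀ := by have := hs i₀; linarith
  have hroom : ∀ i, |s i| + ε₀ ≤ a := fun i => by have := hi₀ i (Finset.mem_univ _); linarith
  set E : ℝ := ∫ t in Icc (-a) a, (∑ i, if s i < t then w i else 0) ^ 2 with hEdef
  -- it suffices to beat every `δ > 0`
  refine le_of_forall_pos_le_add fun δ hδ => ?_
  set C : ℝ := ∑ i, ∑ j, |w i| * |w j| with hCdef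
  have hC : 0 ≤ C := Finset.sum_nonneg fun i _ => Finset.sum_nonneg fun j _ => by positivity
  set B : ℝ := ∑ i, |w i| with hBdef
  set η : ℝ := δ / (2 * (C + 1)) with hηdef
  have hη : 0 < η := by positivity
  have hηC : η * C ≤ δ / 2 := by
    rw [hηdef, div_mul_eq_mul_div, div_le_iff₀ (by positivity)]
    nlinarith
  set ε₁ : ℝ := δ / (2 * (2 * N * c * B ^ 2 + 1)) with hε₁def
  have hden : 0 < 2 * N * c * B ^ 2 + 1 := by positivity
  have hε₁ : 0 < ε₁ := by positivity
  have hε₁B : c * (2 * N * ε₁ * B ^ 2) ≤ δ / 2 := by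
    have e : c * (2 * N * ε₁ * B ^ 2) = (2 * N * c * B ^ 2) * ε₁ := by ring
    rw [e, hε₁def, mul_div_assoc', div_le_iff₀ (by positivity)]
    nlinarith
  -- uniform continuity of `G` on the compact square
  have hUC := (isCompact_Icc.prod isCompact_Icc : IsCompact (Icc (-a) a ×ˢ Icc (-a) a))
    |>.uniformContinuousOn_of_continuous continuous_zetaScrewKernel_uncurry.continuousOn
  rw [Metric.uniformContinuousOn_iff] at hUC
  obtain ⟨θ, hθ, hθ'⟩ := hUC η hη
  -- the bump radius
  set ε : ℝ := min (min θ ε₀) ε₁ / 2 with hεdef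
  have hε : 0 < ε := by positivity
  have hεθ : ε < θ := by
    have h1 := min_le_left (min θ ε₀) ε₁; have h2 := min_le_left θ ε₀
    have h3 : 0 < min (min θ ε₀) ε₁ := lt_min (lt_min hθ hε₀) hε₁
    rw [hεdef]; linarith
  have hεε₀ : ε ≤ ε₀ := by
    have h1 := min_le_left (min θ ε₀) ε₁; have h2 := min_le_right θ ε₀
    have h3 : 0 < min (min θ ε₀) ε₁ := lt_min (lt_min hθ hε₀) hε₁
    rw [hεdef]; linarith
  have hεε₁ : ε ≤ ε₁ := by
    have h1 := min_le_right (min θ ε₀) ε₁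
    have h3 : 0 < min (min θ ε₀) ε₁ := lt_min (lt_min hθ hε₀) hε₁
    rw [hεdef]; linarith
  let β : ContDiffBump (0 : ℝ) := ⟨ε / 2, ε, by positivity, by linarith⟩
  have hβ : β.rOut = ε := rfl
  have hsβ : ∀ i, |s i| + β.rOut ≤ a := fun i => by rw [hβ]; linarith [hroom i]
  -- modulus of `G` near each pair of nodes
  have hG : ∀ i j t u, |t - s i| < β.rOut → |u - s j| < β.rOut →
      |zetaScrewKernel t u - zetaScrewKernel (s i) (s j)| ≤ η := by
    intro i j t u ht hu
    rw [hβ] at ht hu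
    have hmem : ∀ {x c : ℝ}, |x - c| < ε → |c| + β.rOut ≤ a → x ∈ Icc (-a) a := by
      intro x c hx hc
      rw [hβ] at hc
      have h1 : |x| ≤ a := by have := abs_sub_abs_le_abs_sub x c; linarith
      exact ⟨(abs_le.1 h1).1, (abs_le.1 h1).2⟩
    have hsi : ∀ k, s k ∈ Icc (-a) a := fun k =>
      ⟨(abs_le.1 (hs k).le).1, (abs_le.1 (hs k).le).2⟩
    have h := hθ' (t, u) ⟨hmem ht (hsβ i), hmem hu (hsβ j)⟩ (s i, s j) ⟨hsi i, hsi j⟩ ?_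
    · exact (Real.dist_eq _ _ ▸ h).le
    · rw [Prod.dist_eq, Real.dist_eq, Real.dist_eq]
      exact max_lt (ht.trans hεθ) (hu.trans hεθ)
  -- the comb, its primitive, and the coercive inequality on it
  have hmem := comb_mem_screwTestC0 (a := a) s w β hsβ hw
  have hF := screwPrimitive_mem_screwTestC hmem
  have h1 := hcoer _ hF.1 hF.2
  rw [weilQuadratic_eq_zetaScrewForm_deriv ha hF, deriv_screwPrimitive_of_mem hmem,
    re_zetaScrewForm_ofReal] at h1
  -- lower side: the step energy
  have hlow := integral_sq_step_le s w β hsβ hw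
  rw [hβ] at hlow
  -- bilinear expansion of `D(comb, comb)`
  have hρc : ∀ i, Continuous fun u => β.normed volume (u - s i) := fun i => continuous_normed_sub β (s i)
  have h2 : doubleInt a (comb s w β) (comb s w β) =
      ∑ j, w j * ∑ i, w i * doubleInt a (fun u => β.normed volume (u - s j))
        (fun t => β.normed volume (t - s i)) := by
    have e1 : doubleInt a (comb s w β) (comb s w β) =
        ∑ j, w j * doubleInt a (fun u => β.normed volume (u - s j)) (comb s w β) :=
      doubleInt_sum_left Finset.univ w hρc (continuous_comb s w β)
    rw [e1]
    refine Finset.sum_congr rfl fun j _ => ?_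
    have e2 : doubleInt a (fun u => β.normed volume (u - s j)) (comb s w β) =
        ∑ i, w i * doubleInt a (fun u => β.normed volume (u - s j))
          (fun t => β.normed volume (t - s i)) :=
      doubleInt_sum_right Finset.univ w (hρc j) hρc
    rw [e2]
  -- termwise comparison with the point values
  have h3 : |(∑ j, w j * ∑ i, w i * doubleInt a (fun u => β.normed volume (u - s j))
        (fun t => β.normed volume (t - s i)))
      - ∑ j, w j * ∑ i, w i * zetaScrewKernel (s i) (s j)| ≤ η * C := by
    calc |(∑ j, w j * ∑ i, w i * doubleInt a (fun u => β.normed volume (u - s j))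
            (fun t => β.normed volume (t - s i)))
          - ∑ j, w j * ∑ i, w i * zetaScrewKernel (s i) (s j)|
        = |∑ j, w j * ∑ i, w i * (doubleInt a (fun u => β.normed volume (u - s j))
            (fun t => β.normed volume (t - s i)) - zetaScrewKernel (s i) (s j))| := by
          congr 1
          rw [← Finset.sum_sub_distrib]
          refine Finset.sum_congr rfl fun j _ => ?_
          rw [← mul_sub, ← Finset.sum_sub_distrib]
          congr 1
          refine Finset.sum_congr rfl fun i _ => ?_
          ring
      _ ≤ ∑ j, |w j * ∑ i, w i * (doubleInt a (fun u => β.normed volume (u - s j))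
            (fun t => β.normed volume (t - s i)) - zetaScrewKernel (s i) (s j))| :=
          Finset.abs_sum_le_sum_abs _ _
      _ ≤ ∑ j, |w j| * ∑ i, |w i| * η := by
          refine Finset.sum_le_sum fun j _ => ?_
          rw [abs_mul]
          refine mul_le_mul_of_nonneg_left ?_ (abs_nonneg _)
          refine (Finset.abs_sum_le_sum_abs _ _).trans (Finset.sum_le_sum fun i _ => ?_)
          rw [abs_mul]
          exact mul_le_mul_of_nonneg_left (abs_doubleInt_sub_le (a := a) β (hsβ i) (hsβ j) (hG i j))
            (abs_nonneg _)
      _ = η * C := by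
          rw [hCdef, Finset.mul_sum]
          refine Finset.sum_congr rfl fun j _ => ?_
          rw [Finset.mul_sum, Finset.mul_sum]
          refine Finset.sum_congr rfl fun i _ => ?_
          ring
  -- the target double sum, re-indexed
  have h5 : ∑ i, ∑ j, w i * w j * zetaScrewKernel (s i) (s j) =
      ∑ j, w j * ∑ i, w i * zetaScrewKernel (s i) (s j) := by
    rw [Finset.sum_comm]
    refine Finset.sum_congr rfl fun j _ => ?_
    rw [Finset.mul_sum]
    refine Finset.sum_congr rfl fun i _ => ?_
    ring
  rw [h5]
  rw [h2] at h1
  have h6 := (abs_sub_le_iff.1 h3).1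
  -- assemble: `c E ≤ c ∫‖F‖² + c·2NεB² ≤ D + δ/2 ≤ Σ + ηC + δ/2 ≤ Σ + δ`
  have h7 : c * E ≤ c * (∫ t, ‖screwPrimitive a 0 (fun u => ((comb s w β u : ℝ) : ℂ)) t‖ ^ 2)
      + c * (2 * N * ε * B ^ 2) := by
    have := mul_le_mul_of_nonneg_left hlow hc
    rw [hEdef]; linarith
  have h8 : c * (2 * N * ε * B ^ 2) ≤ δ / 2 := by
    have : c * (2 * N * ε * B ^ 2) ≤ c * (2 * N * ε₁ * B ^ 2) := by
      apply mul_le_mul_of_nonneg_left _ hc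
      have hB : 0 ≤ B ^ 2 := sq_nonneg _
      apply mul_le_mul_of_nonneg_right _ hB
      exact mul_le_mul_of_nonneg_left hεε₁ (by positivity)
    linarith
  linarith

end Summit.RiemannHypothesis.RiemannHypothesis.Theorems.IntegerScrew

end
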